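import Summits.ValiantsHypothesis.ValiantsHypothesis.Theorems.KPlusLogSqLawStaticPathGapCharging
import Summits.ValiantsHypothesis.ValiantsHypothesis.Theorems.KPlusLogSqLawStaticPathTransposition

/-!
# Route «KPlusLogSqLaw» — parametric max-weight independent set on a path: EVENTS ≤ n + 2 · RECORD CHANGES along every sweep

HONEST FRAMING.  Helper toward the crux `WeakLifting` (item `stmt-ValiantsHypothesis-19561`, route `KPlusLogSqLaw`, cell `pub-symmetroid`,
seat val-sym-lift-p4 g24, 2026-08-29) on the line of its witness-plan stub `stub_tridiagonalSectorB` (tropical twin of the STATIC tridiagonal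
sector = parametric maximum-weight independent set on a path; located theory `HOME/val-sym-lift-p4/SILENT-FLIP-LAW.md`).  Sequel of
`…StaticPathGapCharging` (the abstract counting core) and `…StaticPathTransposition` (touch points of the alternating fold under one adjacent
transposition).  For the block `i+1, …, i+n` with prefix-sum lines `S_0, …, S_n` (and `S'_0, …, S'_n` for the reversed block) call `u ≤ n` a
LEFT RECORD at `θ` if the alternating fold of `S_0, …, S_u` touches `S_u`, a RIGHT RECORD if the fold of `S'_0, …, S'_{n-u}` touches `S'_{n-u}`, a
RECORD if either (the record set `N(θ) = J^L ∪ J^R` of the memo).  A DISCRETE SWEEP is a sequence of parameters `θ_0, …, θ_T` such that between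
`θ_k` and `θ_{k+1}` only the pair `(S_{x_k}, S_{y_k})`, `x_k < y_k ≤ n`, may change order, the values are pairwise distinct at every `θ_k`, and
the pair is adjacent at `θ_k` (the two sides of one simple crossing; any allowable sequence of the arrangement is such a sweep).  Here:
* `lab_eq_iff_last_touch` — the active index is the last touch point;
* `mem_I_rev_of_mem_I` — MIRROR CLEANLINESS: if every line strictly between `S_α` and the adjacent `S_κ` in index is on its correct side of
  `S_α`, the same holds in the reversed block for the pair `(n-κ, n-α)`;
* `event_iff_records` — at such a parameter the tree's EVENT TEST (`ne_iff_event`: `α` left record, stretch `(α, κ)` clean, `κ` right record)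
  is the memo's (F2): `α` left record, `κ` right record, NO RECORD strictly between;
* `records_iff_of_step` — (F3) across a step whose smaller label is a left record and whose larger label is a right record (in particular
  across every event) no label changes its record status;
* **`card_events_le_of_sweep`** — THE SILENT-FLIP LAW, one-for-two form, for every discrete sweep in which each pair is an event at most
  once: `#{k < T : event at step k} ≤ n + 2 · #{(k, z) : k < T, z ≤ n, z is a record at θ_k ↮ at θ_{k+1}}`.
The identification of event steps with the changes of the unique optimum is `ne_iff_event` (`…StaticPathEvents`); the corollary for chains of
optima is left to the sequel.  Statements about alternating folds of lines; nothing here asserts anything about `WeakLifting`, `TropicalB`,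
`KPlusLogSqLaw`, the stub in its window, `MatrixDescartes` (stmt-ValiantsHypothesis-18050) or `VP ≠ VNP`; the ORDER QUESTION stays open.
-/

set_option linter.dupNamespace false
set_option autoImplicit false

namespace Summit.ValiantsHypothesis.ValiantsHypothesis.Theorems.KPlusLogSqLaw

open Finset Classical

namespace StaticPathFold

noncomputable section

/-! ## 1. The active index is the last touch point -/

/-- a touch point at or below level `k` is at most the active index. [folklore] -/
theorem le_lab_of_touch (a b : ℕ → ℝ) {k j : ℕ} {θ : ℝ} (hj : j ≤ k) (h : fold a b j θ = L a b j θ) :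
    j ≤ lab a b k θ := by
  unfold lab
  exact Nat.le_findGreatest hj h

/-- **the active index at level `k` is `j ≤ k` iff line `j` touches and no line of index in `(j, k]` does.** [folklore] -/
theorem lab_eq_iff_last_touch (a b : ℕ → ℝ) {k j : ℕ} {θ : ℝ} (hj : j ≤ k) :
    lab a b k θ = j ↔ (fold a b j θ = L a b j θ ∧ ∀ z, j < z → z ≤ k → fold a b z θ ≠ L a b z θ) := by
  constructor
  · intro h
    exact ⟨fold_eq_of_lab_eq a b h, fun z h1 h2 => fold_ne_of_lab_lt a b (by rw [h]; exact h1) h2⟩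
  · rintro ⟨h1, h2⟩
    have h3 := le_lab_of_touch a b hj h1
    have h4 := lab_le a b k θ
    by_contra hne
    exact h2 (lab a b k θ) (by omega) h4 (fold_lab_eq a b k θ)

/-! ## 2. Mirror cleanliness and the two forms of the event test -/

section Mirror

variable (w₁ w₀ : ℕ → ℝ)

/-- **MIRROR CLEANLINESS**: at a parameter with pairwise distinct prefix-sum values where no third line lies between `S_α` and `S_κ`
(`α < κ ≤ n`), if every `S_t`, `α < t < κ`, is strictly on its correct side of `S_α`, then in the reversed block every `S'_{t'}`,
`n - κ < t' < n - α`, is strictly on its correct side of `S'_{n-κ}`. [folklore] -/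
theorem mem_I_rev_of_mem_I {i n α κ : ℕ} {τ : ℝ} (hακ : α < κ) (hκn : κ ≤ n)
    (hdis : ∀ p q, p ≤ n → q ≤ n → p ≠ q → L (altA (shift i w₁)) (altB (shift i w₀)) p τ ≠ L (altA (shift i w₁)) (altB (shift i w₀)) q τ)
    (hadj : ∀ x, x ≤ n → x ≠ α → x ≠ κ →
      (L (altA (shift i w₁)) (altB (shift i w₀)) x τ < L (altA (shift i w₁)) (altB (shift i w₀)) α τ ↔
        L (altA (shift i w₁)) (altB (shift i w₀)) x τ < L (altA (shift i w₁)) (altB (shift i w₀)) κ τ))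
    (hI : τ ∈ I (altA (shift i w₁)) (altB (shift i w₀)) (κ - 1) α) :
    τ ∈ I (altA (shift 0 (rev i n w₁))) (altB (shift 0 (rev i n w₀))) (n - α - 1) (n - κ) := by
  set S := L (altA (shift i w₁)) (altB (shift i w₀)) with hS
  intro t' h1 h2
  have hαn : α ≤ n := hακ.le.trans hκn
  have ht'n : t' ≤ n := by omega
  -- the original index `t = n - t'` lies strictly between `α` and `κ`
  have ht1 : α < n - t' := by omega
  have ht2 : n - t' < κ := by omega
  have hIt := hI (n - t') ht1 (by omega)
  have hadjt := hadj (n - t') (Nat.sub_le n t') (by omega) (by omega)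
  -- the comparison with `κ` on the other side, from distinctness
  have hadjt' : (S κ τ < S (n - t') τ ↔ S α τ < S (n - t') τ) := by
    have e1 : S κ τ < S (n - t') τ ↔ ¬ S (n - t') τ < S κ τ :=
      ⟨fun h h' => lt_asymm h h', fun h => lt_of_le_of_ne (not_lt.mp h) (hdis κ (n - t') hκn (Nat.sub_le n t') (by omega))⟩
    have e2 : S α τ < S (n - t') τ ↔ ¬ S (n - t') τ < S α τ :=
      ⟨fun h h' => lt_asymm h h', fun h => lt_of_le_of_ne (not_lt.mp h) (hdis α (n - t') hαn (Nat.sub_le n t') (by omega))⟩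
    rw [e1, e2, hadjt]
  -- what cleanliness says about `t`
  have hclean : (Even (n - t') → S α τ < S (n - t') τ) ∧ (¬ Even (n - t') → S (n - t') τ < S α τ) := by
    unfold gap at hIt
    constructor
    · intro he; rw [if_pos he] at hIt; exact sub_pos.mp hIt
    · intro he; rw [if_neg he] at hIt; exact sub_pos.mp hIt
  have hpar : Even (n - t') ↔ (Even n ↔ Even t') := Nat.even_sub ht'n
  -- unfold the goal and translate the reversed comparisons
  unfold gap
  split_ifs with he
  · rw [sub_pos, rev_lt_iff w₁ w₀ (Nat.sub_le n κ) ht'n, show n - (n - κ) = κ by omega]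
    rcases Nat.even_or_odd n with hn | hn
    · have hpow : ((-1 : ℝ)) ^ (n + 1) = -1 := Odd.neg_one_pow (Even.add_one hn)
      rw [hpow, neg_one_mul, neg_one_mul, neg_lt_neg_iff]
      have het : Even (n - t') := hpar.mpr (iff_of_true hn he)
      exact hadjt'.mpr (hclean.1 het)
    · have hpow : ((-1 : ℝ)) ^ (n + 1) = 1 := Even.neg_one_pow (Odd.add_one hn)
      rw [hpow, one_mul, one_mul]
      have het : ¬ Even (n - t') := fun h => (Nat.not_even_iff_odd.mpr hn) ((hpar.mp h).mpr he)
      exact hadjt.mp (hclean.2 het)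
  · rw [sub_pos, rev_lt_iff w₁ w₀ ht'n (Nat.sub_le n κ), show n - (n - κ) = κ by omega]
    rcases Nat.even_or_odd n with hn | hn
    · have hpow : ((-1 : ℝ)) ^ (n + 1) = -1 := Odd.neg_one_pow (Even.add_one hn)
      rw [hpow, neg_one_mul, neg_one_mul, neg_lt_neg_iff]
      have het : ¬ Even (n - t') := fun h => he ((hpar.mp h).mp hn)
      exact hadjt.mp (hclean.2 het)
    · have hpow : ((-1 : ℝ)) ^ (n + 1) = 1 := Even.neg_one_pow (Odd.add_one hn)
      rw [hpow, one_mul, one_mul]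
      have het : Even (n - t') := hpar.mpr ⟨fun h => absurd h (Nat.not_even_iff_odd.mpr hn), fun h => absurd h he⟩
      exact hadjt'.mpr (hclean.1 het)

/-- **THE TWO FORMS OF THE EVENT TEST AGREE.**  At a parameter with pairwise distinct prefix-sum values where `S_α` and `S_κ` are adjacent
(`α < κ ≤ n`): «`α` is a left record, the stretch `(α, κ)` is clean, `κ` is a right record» (the test of `ne_iff_event`) iff «`α` is a left
record, `κ` is a right record, and no index strictly between is a left or a right record» ((F2) of `HOME/val-sym-lift-p4/SILENT-FLIP-LAW.md`).
[folklore] -/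
theorem event_iff_records {i n α κ : ℕ} {τ : ℝ} (hακ : α < κ) (hκn : κ ≤ n)
    (hdis : ∀ p q, p ≤ n → q ≤ n → p ≠ q → L (altA (shift i w₁)) (altB (shift i w₀)) p τ ≠ L (altA (shift i w₁)) (altB (shift i w₀)) q τ)
    (hadj : ∀ x, x ≤ n → x ≠ α → x ≠ κ →
      (L (altA (shift i w₁)) (altB (shift i w₀)) x τ < L (altA (shift i w₁)) (altB (shift i w₀)) α τ ↔
        L (altA (shift i w₁)) (altB (shift i w₀)) x τ < L (altA (shift i w₁)) (altB (shift i w₀)) κ τ)) :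
    (fold (altA (shift i w₁)) (altB (shift i w₀)) α τ = L (altA (shift i w₁)) (altB (shift i w₀)) α τ ∧
        τ ∈ I (altA (shift i w₁)) (altB (shift i w₀)) (κ - 1) α ∧
        fold (altA (shift 0 (rev i n w₁))) (altB (shift 0 (rev i n w₀))) (n - κ) τ =
          L (altA (shift 0 (rev i n w₁))) (altB (shift 0 (rev i n w₀))) (n - κ) τ) ↔
      (fold (altA (shift i w₁)) (altB (shift i w₀)) α τ = L (altA (shift i w₁)) (altB (shift i w₀)) α τ ∧
        fold (altA (shift 0 (rev i n w₁))) (altB (shift 0 (rev i n w₀))) (n - κ) τ =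
          L (altA (shift 0 (rev i n w₁))) (altB (shift 0 (rev i n w₀))) (n - κ) τ ∧
        ∀ z, α < z → z < κ →
          fold (altA (shift i w₁)) (altB (shift i w₀)) z τ ≠ L (altA (shift i w₁)) (altB (shift i w₀)) z τ ∧
            fold (altA (shift 0 (rev i n w₁))) (altB (shift 0 (rev i n w₀))) (n - z) τ ≠
              L (altA (shift 0 (rev i n w₁))) (altB (shift 0 (rev i n w₀))) (n - z) τ) := by
  set A := altA (shift i w₁) with hA
  set B := altB (shift i w₀) with hB
  set A' := altA (shift 0 (rev i n w₁)) with hA'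
  set B' := altB (shift 0 (rev i n w₀)) with hB'
  constructor
  · rintro ⟨hL, hI, hR⟩
    have hlab : lab A B (κ - 1) τ = α := lab_eq_of A B (by omega) hL hI
    have hI' := mem_I_rev_of_mem_I w₁ w₀ hακ hκn hdis hadj hI
    have hlab' : lab A' B' (n - α - 1) τ = n - κ := lab_eq_of A' B' (by omega) hR hI'
    refine ⟨hL, hR, fun z hz1 hz2 => ⟨?_, ?_⟩⟩
    · exact fold_ne_of_lab_lt A B (by rw [hlab]; exact hz1) (by omega)
    · exact fold_ne_of_lab_lt A' B' (by rw [hlab']; omega) (by omega)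
  · rintro ⟨hL, hR, hno⟩
    have hlab : lab A B (κ - 1) τ = α :=
      (lab_eq_iff_last_touch A B (by omega)).mpr ⟨hL, fun z h1 h2 => (hno z h1 (by omega)).1⟩
    exact ⟨hL, hlab ▸ mem_I_lab A B (κ - 1) τ, hR⟩

/-! ## 3. (F3) No record changes across a step between a left record and a right record -/

/-- **(F3)**: across an adjacent transposition of `(S_α, S_κ)` at which `α` is a left record and `κ` is a right record at `θ` — in particular
across every event — every index `u ≤ n` is a record at `θ'` iff it is a record at `θ` (the left touch can change only at `κ`, which stays a
right record; the right touch only at `α`, which stays a left record). [folklore] -/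
theorem records_iff_of_step {i n α κ : ℕ} {θ θ' : ℝ} (hακ : α < κ) (hκn : κ ≤ n)
    (hord : ∀ p q, p ≤ n → q ≤ n → ¬(p = α ∧ q = κ) → ¬(p = κ ∧ q = α) →
      (L (altA (shift i w₁)) (altB (shift i w₀)) p θ < L (altA (shift i w₁)) (altB (shift i w₀)) q θ ↔
        L (altA (shift i w₁)) (altB (shift i w₀)) p θ' < L (altA (shift i w₁)) (altB (shift i w₀)) q θ'))
    (hdis : ∀ p q, p ≤ n → q ≤ n → p ≠ q → L (altA (shift i w₁)) (altB (shift i w₀)) p θ ≠ L (altA (shift i w₁)) (altB (shift i w₀)) q θ)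
    (hdis' : ∀ p q, p ≤ n → q ≤ n → p ≠ q → L (altA (shift i w₁)) (altB (shift i w₀)) p θ' ≠ L (altA (shift i w₁)) (altB (shift i w₀)) q θ')
    (hadj : ∀ x, x ≤ n → x ≠ α → x ≠ κ →
      (L (altA (shift i w₁)) (altB (shift i w₀)) x θ < L (altA (shift i w₁)) (altB (shift i w₀)) α θ ↔
        L (altA (shift i w₁)) (altB (shift i w₀)) x θ < L (altA (shift i w₁)) (altB (shift i w₀)) κ θ))
    (hL : fold (altA (shift i w₁)) (altB (shift i w₀)) α θ = L (altA (shift i w₁)) (altB (shift i w₀)) α θ)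
    (hR : fold (altA (shift 0 (rev i n w₁))) (altB (shift 0 (rev i n w₀))) (n - κ) θ =
      L (altA (shift 0 (rev i n w₁))) (altB (shift 0 (rev i n w₀))) (n - κ) θ)
    {u : ℕ} (hu : u ≤ n) :
    ((fold (altA (shift i w₁)) (altB (shift i w₀)) u θ' = L (altA (shift i w₁)) (altB (shift i w₀)) u θ' ∨
        fold (altA (shift 0 (rev i n w₁))) (altB (shift 0 (rev i n w₀))) (n - u) θ' =
          L (altA (shift 0 (rev i n w₁))) (altB (shift 0 (rev i n w₀))) (n - u) θ') ↔
      (fold (altA (shift i w₁)) (altB (shift i w₀)) u θ = L (altA (shift i w₁)) (altB (shift i w₀)) u θ ∨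
        fold (altA (shift 0 (rev i n w₁))) (altB (shift 0 (rev i n w₀))) (n - u) θ =
          L (altA (shift 0 (rev i n w₁))) (altB (shift 0 (rev i n w₀))) (n - u) θ)) := by
  have hαn : α ≤ n := hακ.le.trans hκn
  -- hypotheses for the reversed family, pair `(n - κ, n - α)`
  have hord' := rev_ord_of_ord w₁ w₀ hαn hκn hord
  have hdisR := rev_ne_of_ne w₁ w₀ (n := n) hdis
  have hdisR' := rev_ne_of_ne w₁ w₀ (n := n) hdis'
  have hadj' := rev_adj_of_adj w₁ w₀ hαn hκn hdis hadj
  -- left touch: unchanged except possibly at `κ`; right touch: unchanged except possibly at `α`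
  have hLu : u ≠ κ → (fold (altA (shift i w₁)) (altB (shift i w₀)) u θ = L (altA (shift i w₁)) (altB (shift i w₀)) u θ ↔
      fold (altA (shift i w₁)) (altB (shift i w₀)) u θ' = L (altA (shift i w₁)) (altB (shift i w₀)) u θ') := fun huκ =>
    touch_iff_of_transposition hακ hκn hord hdis hdis' hadj hu huκ
  have hRu : u ≠ α → (fold (altA (shift 0 (rev i n w₁))) (altB (shift 0 (rev i n w₀))) (n - u) θ =
        L (altA (shift 0 (rev i n w₁))) (altB (shift 0 (rev i n w₀))) (n - u) θ ↔
      fold (altA (shift 0 (rev i n w₁))) (altB (shift 0 (rev i n w₀))) (n - u) θ' =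
        L (altA (shift 0 (rev i n w₁))) (altB (shift 0 (rev i n w₀))) (n - u) θ') := fun huα =>
    touch_iff_of_transposition (show n - κ < n - α by omega) (Nat.sub_le n α) hord' hdisR hdisR' hadj' (Nat.sub_le n u) (by omega)
  by_cases huκ : u = κ
  · subst huκ
    have hR' := (hRu (by omega)).mp hR
    exact ⟨fun _ => Or.inr hR, fun _ => Or.inr hR'⟩
  · by_cases huα : u = α
    · subst huα
      have hL' := (hLu huκ).mp hL
      exact ⟨fun _ => Or.inl hL, fun _ => Or.inl hL'⟩
    · rw [hLu huκ, hRu huα]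

end Mirror

/-! ## 4. The silent-flip law, one-for-two form, along a discrete sweep -/

section Sweep

variable (w₁ w₀ : ℕ → ℝ)

/-- **THE SILENT-FLIP LAW (one-for-two form) ALONG A DISCRETE SWEEP.**  For the prefix-sum arrangement of the block `i+1, …, i+n` and
parameters `θ 0, …, θ T` such that between `θ k` and `θ (k+1)` only the pair `(S_{x k}, S_{y k})`, `x k < y k ≤ n`, may change order, with
pairwise distinct values at every `θ k` and the pair adjacent at `θ k`, and such that each pair is an EVENT (smaller index a left record,
larger a right record, no record strictly between, at `θ k`) at most once: the number of event steps is at most `n` plus twice the number of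
pairs `(k, z)`, `k < T`, `z ≤ n`, such that `z` is a record at exactly one of `θ k`, `θ (k+1)`
(`HOME/val-sym-lift-p4/SILENT-FLIP-LAW.md`, Theorem A in the form `E ≤ n + 2M`). [folklore] -/
theorem card_events_le_of_sweep (i n T : ℕ) (θ : ℕ → ℝ) (x y : ℕ → ℕ)
    (hxy : ∀ k, k < T → x k < y k ∧ y k ≤ n)
    (hord : ∀ k, k < T → ∀ p q, p ≤ n → q ≤ n → ¬(p = x k ∧ q = y k) → ¬(p = y k ∧ q = x k) →
      (L (altA (shift i w₁)) (altB (shift i w₀)) p (θ k) < L (altA (shift i w₁)) (altB (shift i w₀)) q (θ k) ↔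
        L (altA (shift i w₁)) (altB (shift i w₀)) p (θ (k + 1)) < L (altA (shift i w₁)) (altB (shift i w₀)) q (θ (k + 1))))
    (hdis : ∀ k, k ≤ T → ∀ p q, p ≤ n → q ≤ n → p ≠ q →
      L (altA (shift i w₁)) (altB (shift i w₀)) p (θ k) ≠ L (altA (shift i w₁)) (altB (shift i w₀)) q (θ k))
    (hadj : ∀ k, k < T → ∀ z, z ≤ n → z ≠ x k → z ≠ y k →
      (L (altA (shift i w₁)) (altB (shift i w₀)) z (θ k) < L (altA (shift i w₁)) (altB (shift i w₀)) (x k) (θ k) ↔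
        L (altA (shift i w₁)) (altB (shift i w₀)) z (θ k) < L (altA (shift i w₁)) (altB (shift i w₀)) (y k) (θ k)))
    (hinj : ∀ k, k < T → ∀ k', k' < T → x k = x k' → y k = y k' →
      (fold (altA (shift i w₁)) (altB (shift i w₀)) (x k) (θ k) = L (altA (shift i w₁)) (altB (shift i w₀)) (x k) (θ k) ∧
        fold (altA (shift 0 (rev i n w₁))) (altB (shift 0 (rev i n w₀))) (n - y k) (θ k) =
          L (altA (shift 0 (rev i n w₁))) (altB (shift 0 (rev i n w₀))) (n - y k) (θ k) ∧
        ∀ z, x k < z → z < y k →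
          fold (altA (shift i w₁)) (altB (shift i w₀)) z (θ k) ≠ L (altA (shift i w₁)) (altB (shift i w₀)) z (θ k) ∧
            fold (altA (shift 0 (rev i n w₁))) (altB (shift 0 (rev i n w₀))) (n - z) (θ k) ≠
              L (altA (shift 0 (rev i n w₁))) (altB (shift 0 (rev i n w₀))) (n - z) (θ k)) →
      (fold (altA (shift i w₁)) (altB (shift i w₀)) (x k') (θ k') = L (altA (shift i w₁)) (altB (shift i w₀)) (x k') (θ k') ∧
        fold (altA (shift 0 (rev i n w₁))) (altB (shift 0 (rev i n w₀))) (n - y k') (θ k') =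
          L (altA (shift 0 (rev i n w₁))) (altB (shift 0 (rev i n w₀))) (n - y k') (θ k') ∧
        ∀ z, x k' < z → z < y k' →
          fold (altA (shift i w₁)) (altB (shift i w₀)) z (θ k') ≠ L (altA (shift i w₁)) (altB (shift i w₀)) z (θ k') ∧
            fold (altA (shift 0 (rev i n w₁))) (altB (shift 0 (rev i n w₀))) (n - z) (θ k') ≠
              L (altA (shift 0 (rev i n w₁))) (altB (shift 0 (rev i n w₀))) (n - z) (θ k')) →
      k = k') :
    ((range T).filter (fun k =>
        fold (altA (shift i w₁)) (altB (shift i w₀)) (x k) (θ k) = L (altA (shift i w₁)) (altB (shift i w₀)) (x k) (θ k) ∧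
          fold (altA (shift 0 (rev i n w₁))) (altB (shift 0 (rev i n w₀))) (n - y k) (θ k) =
            L (altA (shift 0 (rev i n w₁))) (altB (shift 0 (rev i n w₀))) (n - y k) (θ k) ∧
          ∀ z, x k < z → z < y k →
            fold (altA (shift i w₁)) (altB (shift i w₀)) z (θ k) ≠ L (altA (shift i w₁)) (altB (shift i w₀)) z (θ k) ∧
              fold (altA (shift 0 (rev i n w₁))) (altB (shift 0 (rev i n w₀))) (n - z) (θ k) ≠
                L (altA (shift 0 (rev i n w₁))) (altB (shift 0 (rev i n w₀))) (n - z) (θ k))).card ≤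
      n + 2 * (((range T) ×ˢ (range (n + 1))).filter (fun kz : ℕ × ℕ =>
        ¬ ((fold (altA (shift i w₁)) (altB (shift i w₀)) kz.2 (θ kz.1) = L (altA (shift i w₁)) (altB (shift i w₀)) kz.2 (θ kz.1) ∨
              fold (altA (shift 0 (rev i n w₁))) (altB (shift 0 (rev i n w₀))) (n - kz.2) (θ kz.1) =
                L (altA (shift 0 (rev i n w₁))) (altB (shift 0 (rev i n w₀))) (n - kz.2) (θ kz.1)) ↔
            (fold (altA (shift i w₁)) (altB (shift i w₀)) kz.2 (θ (kz.1 + 1)) =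
                L (altA (shift i w₁)) (altB (shift i w₀)) kz.2 (θ (kz.1 + 1)) ∨
              fold (altA (shift 0 (rev i n w₁))) (altB (shift 0 (rev i n w₀))) (n - kz.2) (θ (kz.1 + 1)) =
                L (altA (shift 0 (rev i n w₁))) (altB (shift 0 (rev i n w₀))) (n - kz.2) (θ (kz.1 + 1)))))).card := by
  set A := altA (shift i w₁) with hA
  set B := altB (shift i w₀) with hB
  set A' := altA (shift 0 (rev i n w₁)) with hA'
  set B' := altB (shift 0 (rev i n w₀)) with hB'
  -- the record process
  set N : ℕ → Finset ℕ := fun k => (range (n + 1)).filter (fun u =>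
    fold A B u (θ k) = L A B u (θ k) ∨ fold A' B' (n - u) (θ k) = L A' B' (n - u) (θ k)) with hN
  set Ev := (range T).filter (fun k => fold A B (x k) (θ k) = L A B (x k) (θ k) ∧
      fold A' B' (n - y k) (θ k) = L A' B' (n - y k) (θ k) ∧
      ∀ z, x k < z → z < y k → fold A B z (θ k) ≠ L A B z (θ k) ∧ fold A' B' (n - z) (θ k) ≠ L A' B' (n - z) (θ k)) with hEv
  have hmemN : ∀ k u, u ∈ N k ↔ (u ≤ n ∧ (fold A B u (θ k) = L A B u (θ k) ∨ fold A' B' (n - u) (θ k) = L A' B' (n - u) (θ k))) := by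
    intro k u
    rw [hN, mem_filter, mem_range, Nat.lt_succ_iff]
  -- the three hypotheses of the gap-charging lemma
  have h1 : ∀ k ∈ Ev, k < T ∧ x k < y k ∧ y k ≤ n ∧ x k ∈ N k ∧ y k ∈ N k ∧ ∀ z, x k < z → z < y k → z ∉ N k := by
    intro k hk
    obtain ⟨hkT, hL, hR, hno⟩ := mem_filter.mp hk
    rw [mem_range] at hkT
    obtain ⟨hxy1, hyn⟩ := hxy k hkT
    refine ⟨hkT, hxy1, hyn, (hmemN k (x k)).mpr ⟨by omega, Or.inl hL⟩, (hmemN k (y k)).mpr ⟨hyn, Or.inr hR⟩,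
      fun z hz1 hz2 hz => ?_⟩
    obtain ⟨-, h | h⟩ := (hmemN k z).mp hz
    · exact (hno z hz1 hz2).1 h
    · exact (hno z hz1 hz2).2 h
  have h2 : ∀ k ∈ Ev, N (k + 1) = N k := by
    intro k hk
    obtain ⟨hkT, hL, hR, -⟩ := mem_filter.mp hk
    rw [mem_range] at hkT
    obtain ⟨hxy1, hyn⟩ := hxy k hkT
    ext u
    rw [hmemN, hmemN]
    constructor
    · rintro ⟨hu, h⟩
      exact ⟨hu, (records_iff_of_step w₁ w₀ hxy1 hyn (hord k hkT) (hdis k hkT.le) (hdis (k + 1) (by omega)) (hadj k hkT)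
        hL hR hu).mp h⟩
    · rintro ⟨hu, h⟩
      exact ⟨hu, (records_iff_of_step w₁ w₀ hxy1 hyn (hord k hkT) (hdis k hkT.le) (hdis (k + 1) (by omega)) (hadj k hkT)
        hL hR hu).mpr h⟩
  have h3 : ∀ k ∈ Ev, ∀ k' ∈ Ev, x k = x k' → y k = y k' → k = k' := by
    intro k hk k' hk' hx hy
    obtain ⟨hkT, hk2⟩ := mem_filter.mp hk
    obtain ⟨hk'T, hk'2⟩ := mem_filter.mp hk'
    exact hinj k (mem_range.mp hkT) k' (mem_range.mp hk'T) hx hy hk2 hk'2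
  have hmain := card_events_le_add_two_mul_card_changes (n := n) (T := T) (N := N) (x := x) (y := y) (Ev := Ev) h1 h2 h3
  -- identify the change sets
  have hM : ((range T) ×ˢ (range (n + 1))).filter (fun kz : ℕ × ℕ => ¬ (kz.2 ∈ N kz.1 ↔ kz.2 ∈ N (kz.1 + 1))) =
      ((range T) ×ˢ (range (n + 1))).filter (fun kz : ℕ × ℕ =>
        ¬ ((fold A B kz.2 (θ kz.1) = L A B kz.2 (θ kz.1) ∨ fold A' B' (n - kz.2) (θ kz.1) = L A' B' (n - kz.2) (θ kz.1)) ↔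
            (fold A B kz.2 (θ (kz.1 + 1)) = L A B kz.2 (θ (kz.1 + 1)) ∨
              fold A' B' (n - kz.2) (θ (kz.1 + 1)) = L A' B' (n - kz.2) (θ (kz.1 + 1))))) := by
    refine filter_congr (fun kz hkz => ?_)
    obtain ⟨-, hz⟩ := mem_product.mp hkz
    have hzn : kz.2 ≤ n := by have := mem_range.mp hz; omega
    rw [hmemN, hmemN]
    simp only [hzn, true_and]
  rw [hM] at hmain
  exact hmain

end Sweep

end

end StaticPathFold

end Summit.ValiantsHypothesis.ValiantsHypothesis.Theorems.KPlusLogSqLaw
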